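import Literature.AlgebraicGeometry.Frobenioids.Categories
import Literature.AlgebraicGeometry.Frobenioids.CategoriesFactorization
import Literature.AlgebraicGeometry.Frobenioids.Monoids

/-!
# Kernel DAG index — layer L1, part a (MACHINE DRAFT by abc-iut-dag `tools/mkkernel.py`, index v0 of plan/DAG.tsv @2026-08-25T18:35Z, 3 nodes)

THIS FILE PROVES NOTHING NEW AND ASSERTS NOTHING (plan/KERNEL-DAG-SPEC.md). It gives ONE NAME `N_<kernel_id>` to each DAG node whose
statement has LANDED through the gate, knitting the landed declarations BY NAME; `N_<id>_holds` exists iff the node's printed claims are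
theorems OUR kernel checked (it IS those theorems); FACT-style `def … : Prop` claims and `@[claim … "disputed"]` items get a name and no
`_holds`. Nothing here says abc is proved or refuted or takes a side on [IUTchIII] Cor 3.12. typed ≠ discharged; indexed ≠ endorsed.
Filer of the tree copy: abc-iut-c312-2 (`Summits/ABC/IUTFork/DAGL1a.lean`); this draft is regenerated hourly and is not the tree.
FILED COPY (abc-iut-c312-2, post-processed by work/fixdraft.py): claim nodes are claim-form abbrevs without `_holds`;
`_holds` only for DAG rows marked discharged, `_part` otherwise (spec §2(b),(c)); edges by name (§3).
-/

namespace Summit.ABC.IUTFork.DAG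

namespace PartL1a
/-- `StatementOf h` is the statement (a `Prop`) of which the landed `h` is the proof: the index NAMES statements, it never re-types them. -/
abbrev StatementOf {P : Prop} (_h : P) : Prop := P
end PartL1a
open PartL1a

noncomputable section
universe u₁ u₂ u₃ u₄ u₅ u₆ u₇ u₈ u₉

/-- [node FrdI:§0(Monoids) · L1/D1 · [FrdI] FrdI Convention §0, p.p.10 · p401812 · claim] decls 78 · cites→ - -/
def N_FrdI_S0_Monoids : Prop :=
  StatementOf @Literature.AlgebraicGeometry.Frobenioids.isIntegral_iff_isCancelMul.{u₁} ∧
  StatementOf @Literature.AlgebraicGeometry.Frobenioids.IsSharp.isTorsionFree.{u₁} ∧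
  StatementOf @Literature.AlgebraicGeometry.Frobenioids.PerfectionRel.trans.{u₁} ∧
  StatementOf @Literature.AlgebraicGeometry.Frobenioids.perfectionRel_equivalence.{u₁} ∧
  StatementOf @Literature.AlgebraicGeometry.Frobenioids.PerfectionRel.mul.{u₁} ∧
  StatementOf @Literature.AlgebraicGeometry.Frobenioids.Perfection.mk_eq_mk_iff.{u₁} ∧
  StatementOf @Literature.AlgebraicGeometry.Frobenioids.Perfection.mk_surjective.{u₁} ∧
  StatementOf @Literature.AlgebraicGeometry.Frobenioids.Perfection.mk_mul_mk.{u₁} ∧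
  StatementOf @Literature.AlgebraicGeometry.Frobenioids.Perfection.one_def.{u₁} ∧
  StatementOf @Literature.AlgebraicGeometry.Frobenioids.Perfection.mk_one.{u₁} ∧
  StatementOf @Literature.AlgebraicGeometry.Frobenioids.Perfection.mk_pow_mul.{u₁} ∧
  StatementOf @Literature.AlgebraicGeometry.Frobenioids.Perfection.mk_pow.{u₁}
/-- partial witness (DAG row not marked discharged) of `N_FrdI_S0_Monoids`: the landed theorems it names, BY NAME (spec §2(c)); proves nothing new. -/
theorem N_FrdI_S0_Monoids_part : N_FrdI_S0_Monoids := ⟨@Literature.AlgebraicGeometry.Frobenioids.isIntegral_iff_isCancelMul, @Literature.AlgebraicGeometry.Frobenioids.IsSharp.isTorsionFree, @Literature.AlgebraicGeometry.Frobenioids.PerfectionRel.trans, @Literature.AlgebraicGeometry.Frobenioids.perfectionRel_equivalence, @Literature.AlgebraicGeometry.Frobenioids.PerfectionRel.mul, @Literature.AlgebraicGeometry.Frobenioids.Perfection.mk_eq_mk_iff, @Literature.AlgebraicGeometry.Frobenioids.Perfection.mk_surjective, @Literature.AlgebraicGeometry.Frobenioids.Perfection.mk_mul_mk, @Literature.AlgebraicGeometry.Frobenioids.Perfection.one_def,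 @Literature.AlgebraicGeometry.Frobenioids.Perfection.mk_one, @Literature.AlgebraicGeometry.Frobenioids.Perfection.mk_pow_mul, @Literature.AlgebraicGeometry.Frobenioids.Perfection.mk_pow⟩
-- (+33 further theorems of this node not conjoined in the draft)
example := @Literature.AlgebraicGeometry.Frobenioids.NgeOne
example := @Literature.AlgebraicGeometry.Frobenioids.IsTorsionFree
example := @Literature.AlgebraicGeometry.Frobenioids.IsSharp
example := @Literature.AlgebraicGeometry.Frobenioids.IsIntegral
example := @Literature.AlgebraicGeometry.Frobenioids.IsSaturated
example := @Literature.AlgebraicGeometry.Frobenioids.IsPerfect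

/-- [node FrdI:§0(Categories) · L1/D1 · [FrdI] FrdI Convention §0, p.p.13 · p401928 · claim] decls 65 · cites→ - -/
def N_FrdI_S0_Categories : Prop :=
  StatementOf @Literature.AlgebraicGeometry.Frobenioids.IsOneMorphism.isOneObject.{u₁, u₂} ∧
  StatementOf @Literature.AlgebraicGeometry.Frobenioids.IsTerminalObj.isPseudoTerminal.{u₁, u₂} ∧
  StatementOf @Literature.AlgebraicGeometry.Frobenioids.IsFSM.comp.{u₁, u₂} ∧
  StatementOf @Literature.AlgebraicGeometry.Frobenioids.mem_autSub_of_isIso.{u₁, u₂} ∧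
  StatementOf @Literature.AlgebraicGeometry.Frobenioids.IsOfAutTypeObj.isAutSaturatedObj_and.{u₁, u₂} ∧
  StatementOf @Literature.AlgebraicGeometry.Frobenioids.ZeroCommutes.oneCommutes.{u₁, u₂, u₃, u₄, u₅, u₆, u₇, u₈} ∧
  StatementOf @Literature.AlgebraicGeometry.Frobenioids.iso_unique_of_isRigidFunctor.{u₁, u₂, u₃, u₄} ∧
  StatementOf @Literature.AlgebraicGeometry.Frobenioids.IsSkeletalSubcategory.isEquivalence.{u₁, u₂} ∧
  StatementOf @Literature.AlgebraicGeometry.Frobenioids.IsConnectedObj.isQuasiConnected.{u₁, u₂} ∧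
  StatementOf @Literature.AlgebraicGeometry.Frobenioids.IsTotallyEpimorphic.isAlmostTotallyEpimorphic.{u₁, u₂} ∧
  StatementOf @Literature.AlgebraicGeometry.Frobenioids.IsMobile.isNonemptyObj.{u₁, u₂} ∧
  StatementOf @Literature.AlgebraicGeometry.Frobenioids.isMobile_of_cofan_pair.{u₁, u₂}
/-- partial witness (DAG row not marked discharged) of `N_FrdI_S0_Categories`: the landed theorems it names, BY NAME (spec §2(c)); proves nothing new. -/
theorem N_FrdI_S0_Categories_part : N_FrdI_S0_Categories := ⟨@Literature.AlgebraicGeometry.Frobenioids.IsOneMorphism.isOneObject, @Literature.AlgebraicGeometry.Frobenioids.IsTerminalObj.isPseudoTerminal, @Literature.AlgebraicGeometry.Frobenioids.IsFSM.comp, @Literature.AlgebraicGeometry.Frobenioids.mem_autSub_of_isIso, @Literature.AlgebraicGeometry.Frobenioids.IsOfAutTypeObj.isAutSaturatedObj_and, @Literature.AlgebraicGeometry.Frobenioids.ZeroCommutes.oneCommutes, @Literature.AlgebraicGeometry.Frobenioids.iso_unique_of_isRigidFunctor, @Literature.AlgebraicGeometry.Frobenioids.IsSkeletalSubcategory.isEquivalence,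 @Literature.AlgebraicGeometry.Frobenioids.IsConnectedObj.isQuasiConnected, @Literature.AlgebraicGeometry.Frobenioids.IsTotallyEpimorphic.isAlmostTotallyEpimorphic, @Literature.AlgebraicGeometry.Frobenioids.IsMobile.isNonemptyObj, @Literature.AlgebraicGeometry.Frobenioids.isMobile_of_cofan_pair⟩
-- (+9 further theorems of this node not conjoined in the draft)
example := @Literature.AlgebraicGeometry.Frobenioids.IsSlimGroup
example := @Literature.AlgebraicGeometry.Frobenioids.BCat
example := @Literature.AlgebraicGeometry.Frobenioids.IsOneObject
example := @Literature.AlgebraicGeometry.Frobenioids.IsOneMorphism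
example := @Literature.AlgebraicGeometry.Frobenioids.sliceOver
example := @Literature.AlgebraicGeometry.Frobenioids.sliceUnder

/-- [node FrdI:§0(CategoriesFactorization) · L1/D1 · [FrdI] FrdI Convention §0, p.p.17 · p402268 · claim] decls 34 · cites→ - -/
def N_FrdI_S0_CategoriesFactorization : Prop :=
  StatementOf @Literature.AlgebraicGeometry.Frobenioids.IsAbstractlyEquivalent.refl.{u₁, u₂} ∧
  StatementOf @Literature.AlgebraicGeometry.Frobenioids.IsAbstractlyEquivalent.symm.{u₁, u₂} ∧
  StatementOf @Literature.AlgebraicGeometry.Frobenioids.IsAbstractlyEquivalent.trans.{u₁, u₂} ∧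
  StatementOf @Literature.AlgebraicGeometry.Frobenioids.CFP.hom_ext.{u₁, u₂, u₃, u₄, u₅, u₆} ∧
  StatementOf @Literature.AlgebraicGeometry.Frobenioids.CFP.id_fst.{u₁, u₂, u₃, u₄, u₅, u₆} ∧
  StatementOf @Literature.AlgebraicGeometry.Frobenioids.CFP.id_snd.{u₁, u₂, u₃, u₄, u₅, u₆} ∧
  StatementOf @Literature.AlgebraicGeometry.Frobenioids.CFP.comp_fst.{u₁, u₂, u₃, u₄, u₅, u₆} ∧
  StatementOf @Literature.AlgebraicGeometry.Frobenioids.CFP.comp_snd.{u₁, u₂, u₃, u₄, u₅, u₆} ∧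
  StatementOf @Literature.AlgebraicGeometry.Frobenioids.CFP.isEquivalence_proj₁.{u₁, u₂, u₃, u₄, u₅, u₆} ∧
  StatementOf @Literature.AlgebraicGeometry.Frobenioids.IsOfFSMType.not_isFSMI.{u₁, u₂} ∧
  StatementOf @Literature.AlgebraicGeometry.Frobenioids.IsFSMIChain.exists_isFSMI.{u₁, u₂} ∧
  StatementOf @Literature.AlgebraicGeometry.Frobenioids.IsFSMIChain.pos.{u₁, u₂}
/-- partial witness (DAG row not marked discharged) of `N_FrdI_S0_CategoriesFactorization`: the landed theorems it names, BY NAME (spec §2(c)); proves nothing new. -/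
theorem N_FrdI_S0_CategoriesFactorization_part : N_FrdI_S0_CategoriesFactorization := ⟨@Literature.AlgebraicGeometry.Frobenioids.IsAbstractlyEquivalent.refl, @Literature.AlgebraicGeometry.Frobenioids.IsAbstractlyEquivalent.symm, @Literature.AlgebraicGeometry.Frobenioids.IsAbstractlyEquivalent.trans, @Literature.AlgebraicGeometry.Frobenioids.CFP.hom_ext, @Literature.AlgebraicGeometry.Frobenioids.CFP.id_fst, @Literature.AlgebraicGeometry.Frobenioids.CFP.id_snd, @Literature.AlgebraicGeometry.Frobenioids.CFP.comp_fst, @Literature.AlgebraicGeometry.Frobenioids.CFP.comp_snd, @Literature.AlgebraicGeometry.Frobenioids.CFP.isEquivalence_proj₁, @Literature.AlgebraicGeometry.Frobenioids.IsOfFSMType.not_isFSMI, @Literature.AlgebraicGeometry.Frobenioids.IsFSMIChain.exists_isFSMI, @Literature.AlgebraicGeometry.Frobenioids.IsFSMIChain.pos⟩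
-- (+3 further theorems of this node not conjoined in the draft)
example := @Literature.AlgebraicGeometry.Frobenioids.IsAbstractlyEquivalent
example := @Literature.AlgebraicGeometry.Frobenioids.CFP
example := @Literature.AlgebraicGeometry.Frobenioids.CFP.Hom
example := @Literature.AlgebraicGeometry.Frobenioids.CFP.instCategory
example := @Literature.AlgebraicGeometry.Frobenioids.CFP.proj₁
example := @Literature.AlgebraicGeometry.Frobenioids.CFP.proj₂

end

end Summit.ABC.IUTFork.DAG
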